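import Literature.NumberTheory.EllipticCurves.Curve6137MuDescentSelmer
import Literature.NumberTheory.EllipticCurves.CPMuDescentPhiSide
import HarnessLib

/-!
# The `φ̂`-side of the `3`-isogeny descent from the `α`-box over `ℚ`, and `t_3(E_{m,s}) = 0` from the
# generators of the two boxes (Cohen–Pazuki 2009, Thm. 2.1, Prop. 2.2) — generic in `E_{m,s}/ℚ`

Topic `NumberTheory/EllipticCurves`. Curve-independent form of `Curve6137MuDescentSelmer`. For a
Cohen–Pazuki pair over `ℚ` (`V = cpCurve a b → E₂ = threeTorsionModel m₂ s₂`, `t m₂ = 3a`,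
`t³ s₂ = 4a³ + 9b`) and `u ∈ ℚ*` whose `μ₃`-torsor class `[C_u]` lies in `Ш(V/ℚ)`:

* `three_dvd_padicValRat_of_torsorClass_mem_sha` — LOCAL NECESSITY: `3 ∣ v_p(u)` at every prime `p` with
  `v_p(2s₂) = 0 ≤ v_p(2m₂)` (Cohen–Pazuki Thm. 2.1 (2)–(3), «`u ∣ (2b)²`»), via `CPMuDescentLocal` at `ℚ_p`
  and the valuation lemma `Carrier6137.three_dvd_log_of_descent_pow_eq`;
* `cubeClass_mem_closure_of_torsorClass_mem_sha` — hence `[u] ∈ ⟨[p] : p ∈ S⟩` for any finite set `S` of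
  primes containing the exceptions, and if EVERY `[p]`, `p ∈ S`, is a descent class `[α(P)]` of a rational
  point of `E₂` (the FULL box is filled by points: `hgen`) then `[u]` is in the image of `E₂(ℚ)`;
* **`eq_zero_of_mem_sha_of_galH1Map_eq_zero_of_gens`** — so `Ш(V/ℚ) ∩ ker f_* = 0` for every equivariant
  surjection `f` with kernel `⟨T̂⟩` (`MuThreeTorsorImage` + `CPMuDescentGlobal`);
* **`shaCorank_three_eq_zero_of_gens_of_box`**, `forall_mem_sha_three_nsmul_eq_zero_of_gens_of_box` — for
  `E = threeTorsionModel m s` itself (canonical pair `a = m`, `b̂ = 3s − 4m³/9`, `t = 3`,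
  `V = ⟨1, −4m²/3, 0, 0⟩ • Ê`, `CPMuDescentShaThree`): the `α`-box over `ℚ` filled by points (`hgen`) and the
  `α̂`-box over `ℚ(√−3)` sharp (`hbox`, `CPMuDescentPhiSide`) ⇒ **`t_3(E) = 0`**. A cross-prime cell at `3`
  of an explicit `E_{m,s}` = a finite set of primes, one rational point per prime, and the `K3`-box.

## References

* [CohenPazuki2009] H. Cohen, F. Pazuki, Acta Arith. 140 (2009), Thm. 2.1, Prop. 2.2.
* [SilvermanAEC2009] J. H. Silverman, *AEC*, Thm. X.4.2 (a).
-/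

noncomputable section

open scoped Classical

open WeierstrassCurve IsDedekindDomain IsDedekindDomain.HeightOneSpectrum NumberField

namespace Literature.NumberTheory.EllipticCurves

namespace CPMuDescent

open MordellDescent ThreeTorsionDescent MuThreeKernel WithZero
open Literature.NumberTheory.NumberFields

/-! ## The bridge `ℚ_v ↔ v_p` -/

/-- `v(x) = exp(−ord_p x)` for the place `v` of `ℚ` over `p = natGenerator v` (private copy of the bridge).
[cite: CohenPazuki2009, Theorem 2.1 (2)] -/
private theorem valuation_eq_exp_neg_padicValRat'' (v : HeightOneSpectrum (𝓞 ℚ)) {x : ℚ} (hx : x ≠ 0) :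
    v.valuation ℚ x = exp (-padicValRat (Rat.HeightOneSpectrum.natGenerator v) x) := by
  haveI hp : Fact (Rat.HeightOneSpectrum.natGenerator v).Prime := ⟨Rat.HeightOneSpectrum.prime_natGenerator v⟩
  haveI hp' : Fact (Nat.Prime ((Rat.HeightOneSpectrum.primesEquiv v : Nat.Primes) : ℕ)) :=
    ⟨(Rat.HeightOneSpectrum.primesEquiv v).2⟩
  have hequiv := Rat.HeightOneSpectrum.valuation_equiv_padicValuation v
  set n : ℤ := padicValRat (Rat.HeightOneSpectrum.natGenerator v) x with hn
  have h2x : Rat.padicValuation (Rat.HeightOneSpectrum.primesEquiv v) x = exp (-n) := by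
    change Rat.padicValuation (Rat.HeightOneSpectrum.natGenerator v) x = _
    simp [Rat.padicValuation, hx, hn]
  have h2p : Rat.padicValuation (Rat.HeightOneSpectrum.primesEquiv v)
      ((Rat.HeightOneSpectrum.natGenerator v : ℚ) ^ n) = exp (-n) := by
    change Rat.padicValuation (Rat.HeightOneSpectrum.natGenerator v) _ = _
    rw [map_zpow₀, Rat.padicValuation_self, ← exp_zsmul]
    simp
  have h1p : v.valuation ℚ ((Rat.HeightOneSpectrum.natGenerator v : ℚ) ^ n) = exp (-n) := by
    rw [map_zpow₀, Literature.NumberTheory.GaloisRepresentations.Rat.valuation_natGenerator, ← exp_zsmul]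
    simp
  rw [← h1p]
  exact (hequiv.eq_iff).mpr (h2x.trans h2p.symm)

/-! ## Local necessity -/

variable {a b t m₂ s₂ : ℚ}

/-- `s₂ ≠ 0` (`t³ s₂ = 4a³ + 9b ≠ 0`). [cite: CohenPazuki2009, Definition 1.3] -/
theorem s₂_ne_zero (hd : 4 * a ^ 3 + 9 * b ≠ 0) (hs₂ : t ^ 3 * s₂ = 4 * a ^ 3 + 9 * b) : s₂ ≠ 0 := by
  rintro rfl
  exact hd (by rw [← hs₂, mul_zero])

/-- **Local necessity: `[C_u] ∈ Ш(V/ℚ) ⟹ 3 ∣ v_p(u)` at every prime `p` with `v_p(2s₂) = 0 ≤ v_p(2m₂)`.**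
At `ℚ_v` (`v ↔ p`) the locally trivial torsor gives `α(P)^e = u w³` for a local point `P ∈ E₂(ℚ_v)`
(`CPMuDescentLocal`), and `3 ∣ ord_v α(P)` (`three_dvd_log_of_descent_pow_eq`).
[cite: CohenPazuki2009, Theorem 2.1 (2)–(3)] -/
theorem three_dvd_padicValRat_of_torsorClass_mem_sha (hb : b ≠ 0) (hd : 4 * a ^ 3 + 9 * b ≠ 0) (ht : t ≠ 0)
    (hm₂ : t * m₂ = 3 * a) (hs₂ : t ^ 3 * s₂ = 4 * a ^ 3 + 9 * b) {u : ℚ} (hu : u ≠ 0)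
    (hsha : (kernelDatum hb hd).torsorClass hu ∈ (cpCurve a b).sha)
    (p : ℕ) (hp : p.Prime) (hsp : padicValRat p (2 * s₂) = 0) (hmp : 0 ≤ padicValRat p (2 * m₂)) :
    (3 : ℤ) ∣ padicValRat p u := by
  haveI : Fact p.Prime := ⟨hp⟩
  have hs0 : s₂ ≠ 0 := s₂_ne_zero hd hs₂
  -- the place `v` over `p`
  set v : HeightOneSpectrum (𝓞 ℚ) := (Rat.HeightOneSpectrum.primesEquiv (R := 𝓞 ℚ)).symm ⟨p, hp⟩ with hv
  have hvp : Rat.HeightOneSpectrum.natGenerator v = p := by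
    have : (Rat.HeightOneSpectrum.primesEquiv (R := 𝓞 ℚ) v : ℕ) = p := by
      rw [hv, Equiv.apply_symm_apply]
    exact this
  -- local necessity at `ℚ_v`
  obtain ⟨P, w, e, hw, hP⟩ :=
    exists_descent_pow_eq_adicCompletion_of_torsorClass_mem_sha hb hd ht hm₂ hs₂ hu hsha v
  set φ : ℚ →+* v.adicCompletion ℚ := @algebraMap ℚ (v.adicCompletion ℚ) _ _
    (IsDedekindDomain.HeightOneSpectrum.instAlgebraAdicCompletion (𝓞 ℚ) ℚ v) with hφ
  have hval : ∀ x : ℚ, Valued.v (φ x) = v.valuation ℚ x := fun x => valuedAdicCompletion_eq_valuation' v x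
  have key := Carrier6137.three_dvd_log_of_descent_pow_eq Valued.v φ ?_ ?_ hu hw hP
  · rw [hval, valuation_eq_exp_neg_padicValRat'' v hu, hvp, WithZero.log_exp, dvd_neg] at key
    exact key
  · rw [hval, valuation_eq_exp_neg_padicValRat'' v (mul_ne_zero two_ne_zero hs0), hvp, hsp, neg_zero, exp_zero]
  · by_cases hm0 : m₂ = 0
    · rw [hm0, mul_zero, map_zero, map_zero]; exact zero_le_one
    · rw [hval, valuation_eq_exp_neg_padicValRat'' v (mul_ne_zero two_ne_zero hm0), hvp, ← exp_zero, exp_le_exp,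
        neg_nonpos]
      exact hmp

/-! ## The box from its generators -/

/-- `[a^n] = [a]^n` in `ℚ*/ℚ*³`. [cite: CohenPazuki2009, Theorem 2.1] -/
theorem cubeClass_pow' {q : ℚ} (hq : q ≠ 0) (n : ℕ) : cubeClass (q ^ n) = cubeClass q ^ n := by
  induction n with
  | zero => rw [pow_zero, pow_zero, cubeClass_one]
  | succ n ih => rw [pow_succ, pow_succ, cubeClass_mul (pow_ne_zero _ hq) hq, ih]

/-- A product `∏_{p ∈ T} [p]^{e_p}` of members of a subgroup of `ℚ*/ℚ*³` lies in it (private).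
[cite: CohenPazuki2009, Theorem 2.1] -/
private theorem cubeClass_prod_mem (G : Subgroup (CubeUnits ℚ)) (e : ℕ → ℕ) (T : Finset ℕ)
    (hT : ∀ p ∈ T, p.Prime) (hgen : ∀ p ∈ T, cubeClass (p : ℚ) ∈ G) :
    cubeClass (∏ p ∈ T, (p : ℚ) ^ e p) ∈ G := by
  induction T using Finset.induction_on with
  | empty => rw [Finset.prod_empty, cubeClass_one]; exact G.one_mem
  | insert p T hpT ih =>
    have hp : p.Prime := hT p (Finset.mem_insert_self p T)
    have hT' : ∀ q ∈ T, q.Prime := fun q hq => hT q (Finset.mem_insert_of_mem hq)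
    have hne : ∏ q ∈ T, (q : ℚ) ^ e q ≠ 0 :=
      Finset.prod_ne_zero_iff.mpr fun q hq => pow_ne_zero _ (Nat.cast_ne_zero.mpr (hT' q hq).ne_zero)
    rw [Finset.prod_insert hpT, cubeClass_mul (pow_ne_zero _ (Nat.cast_ne_zero.mpr hp.ne_zero)) hne,
      cubeClass_pow' (Nat.cast_ne_zero.mpr hp.ne_zero)]
    exact G.mul_mem (G.pow_mem (hgen p (Finset.mem_insert_self p T)) _)
      (ih hT' fun q hq => hgen q (Finset.mem_insert_of_mem hq))

/-- **`[C_u] ∈ Ш(V/ℚ) ⟹ [u] ∈ ⟨[α(P)] : P ∈ E₂(ℚ)⟩` when the full box is filled by points**: for a finite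
set of primes `S` outside which `v_p(2s₂) = 0 ≤ v_p(2m₂)`, local necessity puts `[u]` in the box
`⟨[p] : p ∈ S⟩`, and `hgen` (every `[p]`, `p ∈ S`, is in the subgroup generated by the descent classes of
rational points) puts the box in the image. [cite: CohenPazuki2009, Theorem 2.1 and Proposition 2.2] -/
theorem cubeClass_mem_closure_of_torsorClass_mem_sha (hb : b ≠ 0) (hd : 4 * a ^ 3 + 9 * b ≠ 0) (ht : t ≠ 0)
    (hm₂ : t * m₂ = 3 * a) (hs₂ : t ^ 3 * s₂ = 4 * a ^ 3 + 9 * b) (S : Finset ℕ) (hS : ∀ p ∈ S, p.Prime)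
    (hout : ∀ p : ℕ, p.Prime → p ∉ S → padicValRat p (2 * s₂) = 0 ∧ 0 ≤ padicValRat p (2 * m₂))
    (hgen : ∀ p ∈ S, cubeClass (p : ℚ) ∈ Subgroup.closure (Set.range
      fun P : (threeTorsionModel m₂ s₂).toAffine.Point => descentClass (threeTorsionModel m₂ s₂) m₂ s₂ P))
    {u : ℚ} (hu : u ≠ 0) (hsha : (kernelDatum hb hd).torsorClass hu ∈ (cpCurve a b).sha) :
    cubeClass u ∈ Subgroup.closure (Set.range
      fun P : (threeTorsionModel m₂ s₂).toAffine.Point => descentClass (threeTorsionModel m₂ s₂) m₂ s₂ P) := by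
  obtain ⟨e, -, hcl⟩ := cubeClass_eq_prod_of_support S hS hu fun p hp hpS =>
    three_dvd_padicValRat_of_torsorClass_mem_sha hb hd ht hm₂ hs₂ hu hsha p hp (hout p hp hpS).1 (hout p hp hpS).2
  rw [hcl]
  exact cubeClass_prod_mem _ e S hS hgen

/-! ## `Ш(V/ℚ) ∩ ker f_* = 0` -/

/-- **`Ш(V/ℚ)[ψ] = 0` from the generators of the `α`-box**: for every `Γ_ℚ`-equivariant surjection
`f : V(ℚ̄) → W'(ℚ̄)` with kernel in `{O, ±T̂}`, no non-zero class of `Ш(V/ℚ)` is killed by `f_*`, provided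
the full `α`-box `⟨[p] : p ∈ S⟩` of `E₂ = threeTorsionModel m₂ s₂` is filled by rational points.
[cite: CohenPazuki2009, Theorem 2.1 and Proposition 2.2] [cite: SilvermanAEC2009, Thm. X.4.2 (a)] -/
theorem eq_zero_of_mem_sha_of_galH1Map_eq_zero_of_gens (hb : b ≠ 0) (hd : 4 * a ^ 3 + 9 * b ≠ 0) (ht : t ≠ 0)
    (hm₂ : t * m₂ = 3 * a) (hs₂ : t ^ 3 * s₂ = 4 * a ^ 3 + 9 * b) (S : Finset ℕ) (hS : ∀ p ∈ S, p.Prime)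
    (hout : ∀ p : ℕ, p.Prime → p ∉ S → padicValRat p (2 * s₂) = 0 ∧ 0 ≤ padicValRat p (2 * m₂))
    (hgen : ∀ p ∈ S, cubeClass (p : ℚ) ∈ Subgroup.closure (Set.range
      fun P : (threeTorsionModel m₂ s₂).toAffine.Point => descentClass (threeTorsionModel m₂ s₂) m₂ s₂ P))
    {W' : WeierstrassCurve ℚ} (f : geomPoints (cpCurve a b) →+ geomPoints W')
    (hf : ∀ (σ : Field.absoluteGaloisGroup ℚ) (P : geomPoints (cpCurve a b)), f (σ • P) = σ • f P)
    (hsurj : Function.Surjective f)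
    (hker : ∀ P, f P = 0 → P = 0 ∨ P = (kernelDatum hb hd).T ∨ P = -(kernelDatum hb hd).T)
    {c : (cpCurve a b).galH1} (hc : c ∈ (cpCurve a b).sha) (h0 : galH1Map f hf c = 0) : c = 0 :=
  (kernelDatum hb hd).eq_zero_of_mem_sha_of_galH1Map_eq_zero_of_closure f hf hsurj hker
    (Set.range fun P : (threeTorsionModel m₂ s₂).toAffine.Point =>
      descentClass (threeTorsionModel m₂ s₂) m₂ s₂ P)
    (by
      rintro _ ⟨P, rfl⟩
      exact torsorClassQuotHom_descentClass hb hd ht hm₂ hs₂ P)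
    (fun _ hu hsha => cubeClass_mem_closure_of_torsorClass_mem_sha hb hd ht hm₂ hs₂ S hS hout hgen hu hsha) hc h0

/-! ## `t_3(E_{m,s}) = 0` from the generators of the `α`-box and the `K3`-box -/

open Literature.NumberTheory.NumberFields.K3 in
/-- **`Ш(E/ℚ)[3] = 0` for `E = threeTorsionModel m s` from: a finite set of primes `S` (outside which
`v_p(2s) = 0 ≤ v_p(2m)`), one descent class `[p] = [α(P)]·…` per `p ∈ S` (`hgen`: the `α`-box over `ℚ` is
filled by rational points), and the sharp `α̂`-box over `ℚ(√−3)` (`hbox`).** Canonical Cohen–Pazuki pair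
`(a, b̂, t) = (m, 3s − 4m³/9, 3)`, `V = ⟨1, −4m²/3, 0, 0⟩ • Ê`. [cite: CohenPazuki2009, Proposition 2.2]
[cite: SilvermanAEC2009, Thm. X.4.2 (a)] -/
theorem forall_mem_sha_three_nsmul_eq_zero_of_gens_of_box {m s : ℚ} [(threeTorsionModel m s).IsElliptic]
    (S : Finset ℕ) (hS : ∀ p ∈ S, p.Prime)
    (hout : ∀ p : ℕ, p.Prime → p ∉ S → padicValRat p (2 * s) = 0 ∧ 0 ≤ padicValRat p (2 * m))
    (hgen : ∀ p ∈ S, cubeClass (p : ℚ) ∈ Subgroup.closure (Set.range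
      fun P : (threeTorsionModel m s).toAffine.Point => descentClass (threeTorsionModel m s) m s P))
    (a₃ b₃ : K3 → K3) (hb₃ : ∀ θ₀ : K3, θ₀ ^ 2 = -3 → b₃ θ₀ ≠ 0)
    (hd₃ : ∀ θ₀ : K3, θ₀ ^ 2 = -3 → 4 * a₃ θ₀ ^ 3 + 9 * b₃ θ₀ ≠ 0)
    (hX₃ : ∀ θ₀ : K3, θ₀ ^ 2 = -3 → (threeTorsionModel m s).baseChange K3 = cpCurve (a₃ θ₀) (b₃ θ₀))
    (hy : ∀ θ₀ : K3, θ₀ ^ 2 = -3 → b₃ θ₀ * θ₀ = algebraMap ℚ K3 s)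
    (hbox : ∀ (θ₀ : K3) (hθ : θ₀ ^ 2 = -3) {u : K3} (hu : u ≠ 0),
      (kernelDatum (hb₃ θ₀ hθ) (hd₃ θ₀ hθ)).torsorClass hu ∈ (cpCurve (a₃ θ₀) (b₃ θ₀)).sha →
        (∃ r : ℚ, QuadraticAlgebra.norm u = r ^ 3) → (kernelDatum (hb₃ θ₀ hθ) (hd₃ θ₀ hθ)).torsorClass hu = 0) :
    ∀ c ∈ (threeTorsionModel m s).sha, 3 • c = 0 → c = 0 :=
  forall_mem_sha_three_nsmul_eq_zero_of_boxes canonical_b_ne_zero canonical_d_ne_zero _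
    (cpCurve_eq_variableChange_threeIsogenyCodomain m s)
    (fun f hf hsurj hker _ hc h0 => eq_zero_of_mem_sha_of_galH1Map_eq_zero_of_gens canonical_b_ne_zero
      canonical_d_ne_zero (t := 3) (by norm_num) (by ring) (by ring) S hS hout hgen f hf hsurj hker hc h0)
    a₃ b₃ hb₃ hd₃ hX₃ hy hbox

open Literature.NumberTheory.NumberFields.K3 in
/-- **`t_3(E_{m,s}) = corank_{ℤ₃} Ш(E/ℚ)[3^∞] = 0` from the generators of the `α`-box and the sharp `K3`-box**
— the form in which a cross-prime cell at `3` is booked: `S`, one rational point per `p ∈ S`, and the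
`α̂`-box over `ℚ(√−3)`. [cite: CohenPazuki2009, Proposition 2.2] [cite: SilvermanAEC2009, Thm. X.4.2 (a)] -/
theorem shaCorank_three_eq_zero_of_gens_of_box {m s : ℚ} [(threeTorsionModel m s).IsElliptic]
    (S : Finset ℕ) (hS : ∀ p ∈ S, p.Prime)
    (hout : ∀ p : ℕ, p.Prime → p ∉ S → padicValRat p (2 * s) = 0 ∧ 0 ≤ padicValRat p (2 * m))
    (hgen : ∀ p ∈ S, cubeClass (p : ℚ) ∈ Subgroup.closure (Set.range
      fun P : (threeTorsionModel m s).toAffine.Point => descentClass (threeTorsionModel m s) m s P))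
    (a₃ b₃ : K3 → K3) (hb₃ : ∀ θ₀ : K3, θ₀ ^ 2 = -3 → b₃ θ₀ ≠ 0)
    (hd₃ : ∀ θ₀ : K3, θ₀ ^ 2 = -3 → 4 * a₃ θ₀ ^ 3 + 9 * b₃ θ₀ ≠ 0)
    (hX₃ : ∀ θ₀ : K3, θ₀ ^ 2 = -3 → (threeTorsionModel m s).baseChange K3 = cpCurve (a₃ θ₀) (b₃ θ₀))
    (hy : ∀ θ₀ : K3, θ₀ ^ 2 = -3 → b₃ θ₀ * θ₀ = algebraMap ℚ K3 s)
    (hbox : ∀ (θ₀ : K3) (hθ : θ₀ ^ 2 = -3) {u : K3} (hu : u ≠ 0),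
      (kernelDatum (hb₃ θ₀ hθ) (hd₃ θ₀ hθ)).torsorClass hu ∈ (cpCurve (a₃ θ₀) (b₃ θ₀)).sha →
        (∃ r : ℚ, QuadraticAlgebra.norm u = r ^ 3) → (kernelDatum (hb₃ θ₀ hθ) (hd₃ θ₀ hθ)).torsorClass hu = 0) :
    (threeTorsionModel m s).shaCorank 3 = 0 :=
  haveI : Fact (Nat.Prime 3) := ⟨Nat.prime_three⟩
  shaCorank_eq_zero_of_forall _ 3
    (forall_mem_sha_three_nsmul_eq_zero_of_gens_of_box S hS hout hgen a₃ b₃ hb₃ hd₃ hX₃ hy hbox)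

end CPMuDescent

end Literature.NumberTheory.EllipticCurves

end
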